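import Mathlib
import Summits.Ventures.PercRepro2.CrossAPrimeA1VDict
import Summits.Ventures.PercRepro2.Harris

/-!
# The middle-upper Bernstein coefficient `B₂` of `crossA′so` along an `a₁–v` edge is nonnegative
(blind cell PercRepro2, p5 g32; `proofs/P5-OEDGE.md` §42 (8), S4 §2.4 (s) addendum 19)

For an edge `e = {a₁, v}` of weight `q`, `crossA′so(p) = (1−q)³B₀ + 3q(1−q)²B₁ + 3q²(1−q)B₂ + q³B₃`
with `B₀ = crossA′so(p[e ↦ 0])`, `B₃ = crossA′so(p[e ↦ 1])` (`CrossAPrimeA1V`) and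
`3B₂ = 2Z₁D₁ + 2Z₁Dv₀ + 2Z₀D₁ − (2 − π₀)x₁y₁ − y₁p₁₀ − x₁p₂₀`, where the subscript `1` masses are
the `Q`-masses at `p[e ↦ 1]` and the subscript `0` masses those at `p[e ↦ 0]`
(`crossA'so_bernstein_a1v`).  THE DICTIONARY (`prob_update_one_Q_inter`): a `Q`-mass at `p[e ↦ 1]`
is the mass at `p[e ↦ 0]` of the same `a₂`-event under the avoidance of `{a₁, v}` (opening `e`
merges `v` into `C(a₁)`: `OneEdge.conn_update_true_iff`).  THE SIGN (`B2_nonneg`): from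
`x₁y₁ ≤ Z₁D₁` (positive association of `C(a₂)` under the avoidance of `{a₁, v}`,
`bhk_same_cluster_events_avoid`), `p₁₀·Z₁ ≤ x₁·P(Q,vL)` (the functional BHK under that avoidance
with the increasing functional `1 − g_v`, `bhk_univ_avoid` + the tower identity
`prob_clusterIn_outside_inter_avoid_eq_expect`), `P(Q,vL) ≤ π₀Z₀` (Harris) and `Z₁ ≤ Z₀`:
`3B₂ ≥ π₀Z₁D₁ + 2Z₁Dv₀ + 2(1 − π₀)Z₀D₁ ≥ 0`.  With `B₃ ≥ 0` (kernel) and `B₁ ≥ 0` (open) this is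
the a₁–v edge of the a₁-edge induction skeleton.  Own work; standard axioms.
-/

namespace Summit.Ventures.PercRepro2

open LeafRowPendantRootSO CrossAPrimeA1V CrossAPrimeA1VDict

namespace CrossAPrimeA1VMid

section Cubic

variable {V : Type*} {E : Type*} [Fintype E] [DecidableEq E] {R : Type*} [Field R]

/-- The three-copy pattern of `crossA′so` with the copies on the measures `pa, pb, pc`:
`2·Z(pa)·P(Q,vL,oH,bH)(pb) + π_v(pc)·P(Q,oH)(pa)·P(Q,bH)(pb) − P(Q,bH)(pa)·P(Q,vL,oH)(pb)
− P(Q,oH)(pa)·P(Q,vL,bH)(pb)`; `crossA′so(p) = crossPat p p p`. -/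
noncomputable def crossPat (pa pb pc : E → R) (ends : E → Sym2 V) (o a₁ a₂ v b : V) : R :=
  2 * prob pa (avoidAll ends a₂ {a₁}) *
      prob pb (avoidAll ends a₂ {a₁} ∩ (connEvent ends a₁ v ∩ (connEvent ends a₂ o ∩ connEvent ends a₂ b))) -
    prob pa (avoidAll ends a₂ {a₁} ∩ connEvent ends a₂ b) *
      prob pb (avoidAll ends a₂ {a₁} ∩ (connEvent ends a₁ v ∩ connEvent ends a₂ o)) +
    prob pc (connEvent ends a₁ v) * prob pa (avoidAll ends a₂ {a₁} ∩ connEvent ends a₂ o) *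
      prob pb (avoidAll ends a₂ {a₁} ∩ connEvent ends a₂ b) -
    prob pa (avoidAll ends a₂ {a₁} ∩ connEvent ends a₂ o) *
      prob pb (avoidAll ends a₂ {a₁} ∩ (connEvent ends a₁ v ∩ connEvent ends a₂ b))

/-- `crossA′so` is the diagonal pattern. -/
lemma crossA'so_eq_crossPat (p : E → R) (ends : E → Sym2 V) (o a₁ a₂ v b : V) :
    crossA'so p ends o a₁ a₂ v b = crossPat p p p ends o a₁ a₂ v b := rfl

/-- **The one-edge cubic of `crossA′so`** (any edge `e`, weight `q = p e`):
`crossA′so(p) = (1−q)³·Φ₀₀₀ + q(1−q)²·(Φ₁₀₀ + Φ₀₁₀ + Φ₀₀₁) + q²(1−q)·(Φ₁₁₀ + Φ₁₀₁ + Φ₀₁₁) + q³·Φ₁₁₁`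
with `Φ_ε = crossPat` on the measures `p[e ↦ ε_i]`. -/
theorem crossA'so_pin_cubic (p : E → R) (ends : E → Sym2 V) (e : E) (o a₁ a₂ v b : V) :
    crossA'so p ends o a₁ a₂ v b =
      (1 - p e) ^ 3 * crossPat (Function.update p e 0) (Function.update p e 0)
          (Function.update p e 0) ends o a₁ a₂ v b +
        p e * (1 - p e) ^ 2 *
          (crossPat (Function.update p e 1) (Function.update p e 0) (Function.update p e 0)
              ends o a₁ a₂ v b +
            crossPat (Function.update p e 0) (Function.update p e 1) (Function.update p e 0)
              ends o a₁ a₂ v b +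
            crossPat (Function.update p e 0) (Function.update p e 0) (Function.update p e 1)
              ends o a₁ a₂ v b) +
        p e ^ 2 * (1 - p e) *
          (crossPat (Function.update p e 1) (Function.update p e 1) (Function.update p e 0)
              ends o a₁ a₂ v b +
            crossPat (Function.update p e 1) (Function.update p e 0) (Function.update p e 1)
              ends o a₁ a₂ v b +
            crossPat (Function.update p e 0) (Function.update p e 1) (Function.update p e 1)
              ends o a₁ a₂ v b) +
        p e ^ 3 * crossPat (Function.update p e 1) (Function.update p e 1)
          (Function.update p e 1) ends o a₁ a₂ v b := by
  have h : ∀ A : Set (Config E), prob p A =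
      p e * prob (Function.update p e 1) A + (1 - p e) * prob (Function.update p e 0) A :=
    fun A => prob_eq_pin p A e
  unfold crossA'so crossPat
  rw [h (avoidAll ends a₂ {a₁}),
    h (avoidAll ends a₂ {a₁} ∩ (connEvent ends a₁ v ∩ (connEvent ends a₂ o ∩ connEvent ends a₂ b))),
    h (avoidAll ends a₂ {a₁} ∩ connEvent ends a₂ b),
    h (avoidAll ends a₂ {a₁} ∩ (connEvent ends a₁ v ∩ connEvent ends a₂ o)),
    h (connEvent ends a₁ v), h (avoidAll ends a₂ {a₁} ∩ connEvent ends a₂ o),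
    h (avoidAll ends a₂ {a₁} ∩ (connEvent ends a₁ v ∩ connEvent ends a₂ b))]
  ring

end Cubic

section Main

variable {V : Type*} {E : Type*} [Fintype E] [DecidableEq E] [Fintype V] [DecidableEq V]
  {R : Type*} [Field R] [LinearOrder R] [IsStrictOrderedRing R]
variable {ends : E → Sym2 V} {e : E} {a₁ v : V}

omit [Fintype E] [DecidableEq E] [Fintype V] in
/-- The double avoidance refines `Q`. -/
lemma avoid_pair_subset (a₂ : V) : avoidAll ends a₂ {a₁, v} ⊆ avoidAll ends a₂ {a₁} := by
  intro ω hω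
  rw [mem_avoidAll]
  intro x hx
  rw [Finset.mem_singleton] at hx
  subst hx
  exact fun h => (mem_avoidAll_insert_iff.1 hω).1 (mem_cluster.2 h)

/-- **The middle-upper coefficient of the `a₁–v` edge is nonnegative**:
`0 ≤ Φ₁₁₀ + Φ₁₀₁ + Φ₀₁₁ (= 3B₂)` for `e = {a₁, v}`. -/
theorem B2_nonneg {p : E → R} (hp : IsProbVec p) (he : ends e = s(a₁, v)) (o a₂ b : V) :
    0 ≤ crossPat (Function.update p e 1) (Function.update p e 1) (Function.update p e 0)
          ends o a₁ a₂ v b +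
        crossPat (Function.update p e 1) (Function.update p e 0) (Function.update p e 1)
          ends o a₁ a₂ v b +
        crossPat (Function.update p e 0) (Function.update p e 1) (Function.update p e 1)
          ends o a₁ a₂ v b := by
  classical
  set p₀ := Function.update p e 0 with hp₀
  set p₁ := Function.update p e 1 with hp₁
  have hp0 : IsProbVec p₀ := hp.update e le_rfl zero_le_one
  unfold crossPat
  -- at `p₁` the `vL`-events are sure
  rw [prob_update_one_inter_vL p he, prob_update_one_inter_vL p he, prob_update_one_inter_vL p he,
    prob_update_one_vL p he]
  -- the dictionary: `p₁`-masses of `Q`-events are `p₀`-masses under the double avoidance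
  have dZ : prob p₁ (avoidAll ends a₂ {a₁}) = prob p₀ (avoidAll ends a₂ {a₁, v}) := by
    have := prob_update_one_Q_inter (R := R) p he (a₂ := a₂) (X := Set.univ) (hX_univ (a₂ := a₂))
    simpa only [Set.inter_univ] using this
  have dx : prob p₁ (avoidAll ends a₂ {a₁} ∩ connEvent ends a₂ o) =
      prob p₀ (avoidAll ends a₂ {a₁, v} ∩ connEvent ends a₂ o) :=
    prob_update_one_Q_inter p he (hX_conn he a₂ o)
  have dy : prob p₁ (avoidAll ends a₂ {a₁} ∩ connEvent ends a₂ b) =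
      prob p₀ (avoidAll ends a₂ {a₁, v} ∩ connEvent ends a₂ b) :=
    prob_update_one_Q_inter p he (hX_conn he a₂ b)
  have dD : prob p₁ (avoidAll ends a₂ {a₁} ∩ (connEvent ends a₂ o ∩ connEvent ends a₂ b)) =
      prob p₀ (avoidAll ends a₂ {a₁, v} ∩ (connEvent ends a₂ o ∩ connEvent ends a₂ b)) :=
    prob_update_one_Q_inter p he (hX_inter (hX_conn he a₂ o) (hX_conn he a₂ b))
  rw [dZ, dx, dy, dD]
  -- names
  set Z₁ := prob p₀ (avoidAll ends a₂ {a₁, v}) with hZ₁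
  set Z₀ := prob p₀ (avoidAll ends a₂ {a₁}) with hZ₀
  set x₁ := prob p₀ (avoidAll ends a₂ {a₁, v} ∩ connEvent ends a₂ o) with hx₁
  set y₁ := prob p₀ (avoidAll ends a₂ {a₁, v} ∩ connEvent ends a₂ b) with hy₁
  set D₁ := prob p₀ (avoidAll ends a₂ {a₁, v} ∩ (connEvent ends a₂ o ∩ connEvent ends a₂ b)) with hD₁
  set Dv := prob p₀ (avoidAll ends a₂ {a₁} ∩ (connEvent ends a₁ v ∩ (connEvent ends a₂ o ∩ connEvent ends a₂ b))) with hDv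
  set q₁ := prob p₀ (avoidAll ends a₂ {a₁} ∩ (connEvent ends a₁ v ∩ connEvent ends a₂ o)) with hq₁
  set q₂ := prob p₀ (avoidAll ends a₂ {a₁} ∩ (connEvent ends a₁ v ∩ connEvent ends a₂ b)) with hq₂
  set L₀ := prob p₀ (avoidAll ends a₂ {a₁} ∩ connEvent ends a₁ v) with hL₀
  set π₀ := prob p₀ (connEvent ends a₁ v) with hπ₀
  -- the bounds
  have hPA : x₁ * y₁ ≤ D₁ * Z₁ := by
    have h := bhk_same_cluster_events_avoid p₀ hp0 ends a₂ {a₁, v} (𝓤 := {W | o ∈ W})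
      (𝓥 := {W | b ∈ W}) (fun _ _ hWW' ho => hWW' ho) (fun _ _ hWW' hb => hWW' hb)
    have e3 : clusterInEvent ends a₂ ({W | o ∈ W} ∩ {W | b ∈ W}) =
        connEvent ends a₂ o ∩ connEvent ends a₂ b := by
      ext ω; simp [clusterInEvent, connEvent]
    rw [clusterInEvent_mem_eq, clusterInEvent_mem_eq, e3, Set.inter_comm _ (avoidAll ends a₂ {a₁, v}),
      Set.inter_comm _ (avoidAll ends a₂ {a₁, v}), Set.inter_comm _ (avoidAll ends a₂ {a₁, v})] at h
    exact h
  have hu₁ : q₁ * Z₁ ≤ x₁ * L₀ := bhk_vL_avoid_pair p₀ hp0 a₂ o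
  have hu₂ : q₂ * Z₁ ≤ y₁ * L₀ := bhk_vL_avoid_pair p₀ hp0 a₂ b
  have hLZ : L₀ ≤ Z₀ := prob_mono hp0 Set.inter_subset_left
  have hZZ : Z₁ ≤ Z₀ := prob_mono hp0 (avoid_pair_subset a₂)
  have hx₁Z : x₁ ≤ Z₁ := prob_mono hp0 Set.inter_subset_left
  have hy₁Z : y₁ ≤ Z₁ := prob_mono hp0 Set.inter_subset_left
  have hD₁Z : D₁ ≤ Z₁ := prob_mono hp0 Set.inter_subset_left
  have hZ₁0 : 0 ≤ Z₁ := prob_nonneg hp0 _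
  have hx₁0 : 0 ≤ x₁ := prob_nonneg hp0 _
  have hy₁0 : 0 ≤ y₁ := prob_nonneg hp0 _
  have hD₁0 : 0 ≤ D₁ := prob_nonneg hp0 _
  have hDv0 : 0 ≤ Dv := prob_nonneg hp0 _
  have hq₁0 : 0 ≤ q₁ := prob_nonneg hp0 _
  have hq₂0 : 0 ≤ q₂ := prob_nonneg hp0 _
  have hL0 : 0 ≤ L₀ := prob_nonneg hp0 _
  have hπ0 : 0 ≤ π₀ := prob_nonneg hp0 _
  have hπ1 : π₀ ≤ 1 := prob_le_one hp0 _
  have hZ₀0 : 0 ≤ Z₀ := prob_nonneg hp0 _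
  -- the target times `Z₁` (the `x₀, y₀` terms of `Φ₁₀₁ + Φ₀₁₁` cancel)
  have key : 0 ≤ Z₁ * (2 * Z₁ * D₁ + 2 * Z₁ * Dv + 2 * Z₀ * D₁ + π₀ * x₁ * y₁ - 2 * x₁ * y₁ -
      y₁ * q₁ - x₁ * q₂) := by
    have t1 : y₁ * q₁ * Z₁ ≤ D₁ * Z₁ * L₀ := by
      have := mul_le_mul_of_nonneg_left hu₁ hy₁0
      have := mul_le_mul_of_nonneg_right hPA hL0
      nlinarith
    have t2 : x₁ * q₂ * Z₁ ≤ D₁ * Z₁ * L₀ := by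
      have := mul_le_mul_of_nonneg_left hu₂ hx₁0
      have := mul_le_mul_of_nonneg_right hPA hL0
      nlinarith
    have t3 : x₁ * y₁ * Z₁ ≤ D₁ * Z₁ * Z₁ := mul_le_mul_of_nonneg_right hPA hZ₁0
    have t4 : 0 ≤ Z₁ * D₁ * (Z₀ - L₀) := mul_nonneg (mul_nonneg hZ₁0 hD₁0) (sub_nonneg.2 hLZ)
    have t6 : 0 ≤ Z₁ * Z₁ * Dv := mul_nonneg (mul_nonneg hZ₁0 hZ₁0) hDv0
    have t7 : 0 ≤ π₀ * Z₁ * (x₁ * y₁) := mul_nonneg (mul_nonneg hπ0 hZ₁0) (mul_nonneg hx₁0 hy₁0)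
    linarith [t1, t2, t3, t4, t6, t7]
  have hS : 0 ≤ 2 * Z₁ * D₁ + 2 * Z₁ * Dv + 2 * Z₀ * D₁ + π₀ * x₁ * y₁ - 2 * x₁ * y₁ -
      y₁ * q₁ - x₁ * q₂ := by
    rcases eq_or_lt_of_le hZ₁0 with hZ | hZ
    · have hx : x₁ = 0 := le_antisymm (by rw [← hZ] at hx₁Z; exact hx₁Z) hx₁0
      have hy : y₁ = 0 := le_antisymm (by rw [← hZ] at hy₁Z; exact hy₁Z) hy₁0
      have hD : D₁ = 0 := le_antisymm (by rw [← hZ] at hD₁Z; exact hD₁Z) hD₁0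
      rw [← hZ, hx, hy, hD]
      linarith
    · exact (mul_nonneg_iff_of_pos_left hZ).1 key
  linarith [hS]

/-- **Along an `a₁–v` edge** `e` of weight `q`:
`crossA′so(p) ≥ (1 − q)³·crossA′so(p[e ↦ 0]) + q(1 − q)²·(Φ₁₀₀ + Φ₀₁₀ + Φ₀₀₁)` — the coefficients
`B₂` and `B₃` are nonnegative; only `B₁` (the second summand) is the open part. -/
theorem crossA'so_a1v_lower {p : E → R} (hp : IsProbVec p) (he : ends e = s(a₁, v)) (o a₂ b : V) :
    (1 - p e) ^ 3 * crossA'so (Function.update p e 0) ends o a₁ a₂ v b +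
        p e * (1 - p e) ^ 2 *
          (crossPat (Function.update p e 1) (Function.update p e 0) (Function.update p e 0)
              ends o a₁ a₂ v b +
            crossPat (Function.update p e 0) (Function.update p e 1) (Function.update p e 0)
              ends o a₁ a₂ v b +
            crossPat (Function.update p e 0) (Function.update p e 0) (Function.update p e 1)
              ends o a₁ a₂ v b) ≤
      crossA'so p ends o a₁ a₂ v b := by
  rw [crossA'so_pin_cubic p ends e o a₁ a₂ v b, crossA'so_eq_crossPat (Function.update p e 0)]
  have h2 := B2_nonneg hp he o a₂ b
  have h3 : 0 ≤ crossPat (Function.update p e 1) (Function.update p e 1) (Function.update p e 1)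
      ends o a₁ a₂ v b := by
    rw [← crossA'so_eq_crossPat]
    exact crossA'so_nonneg_update_one hp he
  have hq0 := hp.nonneg e
  have hq1 := hp.le_one e
  have c2 : 0 ≤ p e ^ 2 * (1 - p e) := mul_nonneg (sq_nonneg _) (sub_nonneg.2 hq1)
  have c3 : 0 ≤ p e ^ 3 := pow_nonneg hq0 3
  nlinarith [mul_nonneg c2 h2, mul_nonneg c3 h3]

omit [Fintype E] [DecidableEq E] [Fintype V] in
/-- The double avoidance is a decreasing event. -/
lemma isLowerSet_avoid_pair (a₂ : V) : IsLowerSet (avoidAll ends a₂ {a₁, v}) :=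
  fun _ _ h hω y hy hc => hω y hy (conn_mono h hc)

omit [Fintype E] [DecidableEq E] [Fintype V] in
/-- `Q ∩ vL ∩ X ⊆ {a₂ ↮ {a₁,v}} ∩ X`. -/
lemma Q_inter_vL_inter_subset (a₂ : V) (X : Set (Config E)) :
    avoidAll ends a₂ {a₁} ∩ (connEvent ends a₁ v ∩ X) ⊆ avoidAll ends a₂ {a₁, v} ∩ X := by
  rw [← Set.inter_assoc, Q_inter_vL_eq' a₂, Set.inter_assoc]
  exact Set.inter_subset_right

/-- **`E₁ ≥ 0` along an `a₁–v` edge**: `crossA′so(p[e ↦ 0]) ≤ Φ₁₀₀ + Φ₀₁₀ + Φ₀₀₁ (= 3B₁)`.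
With the `v`-status split of the `p[e ↦ 0]`-masses (`L₀ = P(Q,vL)` etc.) the certificate is
`L₀·E₁ = 2L₀²D_L + 2L₀Z_K D_L + 2L₀Z_K D_F + 2L₀Z_F D_L + L₀x_F y_F + 2L₀(Z₁D₁ − x₁y₁) + π₀L₀x_F y_L
+ π₀L₀x_F y_F + (1−π₀)L₀x_K y_K + π₀x_L(y₁L₀ − y_L Z₁) + x_L y_L(π₀Z₁ − L₀)` (PA of `C(a₂)` under
the avoidance of `{a₁,v}`, `bhk_vL_avoid_pair`, Harris for `{a₂ ↮ {a₁,v}}` against `vL`); the case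
`L₀ = 0` separately. -/
theorem E1_nonneg {p : E → R} (hp : IsProbVec p) (he : ends e = s(a₁, v)) (o a₂ b : V) :
    crossA'so (Function.update p e 0) ends o a₁ a₂ v b ≤
      crossPat (Function.update p e 1) (Function.update p e 0) (Function.update p e 0)
          ends o a₁ a₂ v b +
        crossPat (Function.update p e 0) (Function.update p e 1) (Function.update p e 0)
          ends o a₁ a₂ v b +
        crossPat (Function.update p e 0) (Function.update p e 0) (Function.update p e 1)
          ends o a₁ a₂ v b := by
  classical
  set p₀ := Function.update p e 0 with hp₀
  set p₁ := Function.update p e 1 with hp₁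
  have hp0 : IsProbVec p₀ := hp.update e le_rfl zero_le_one
  rw [crossA'so_eq_crossPat]
  unfold crossPat
  rw [prob_update_one_inter_vL p he, prob_update_one_inter_vL p he, prob_update_one_inter_vL p he,
    prob_update_one_vL p he]
  have dZ : prob p₁ (avoidAll ends a₂ {a₁}) = prob p₀ (avoidAll ends a₂ {a₁, v}) := by
    have := prob_update_one_Q_inter (R := R) p he (a₂ := a₂) (X := Set.univ) (hX_univ (a₂ := a₂))
    simpa only [Set.inter_univ] using this
  have dx : prob p₁ (avoidAll ends a₂ {a₁} ∩ connEvent ends a₂ o) =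
      prob p₀ (avoidAll ends a₂ {a₁, v} ∩ connEvent ends a₂ o) :=
    prob_update_one_Q_inter p he (hX_conn he a₂ o)
  have dy : prob p₁ (avoidAll ends a₂ {a₁} ∩ connEvent ends a₂ b) =
      prob p₀ (avoidAll ends a₂ {a₁, v} ∩ connEvent ends a₂ b) :=
    prob_update_one_Q_inter p he (hX_conn he a₂ b)
  have dD : prob p₁ (avoidAll ends a₂ {a₁} ∩ (connEvent ends a₂ o ∩ connEvent ends a₂ b)) =
      prob p₀ (avoidAll ends a₂ {a₁, v} ∩ (connEvent ends a₂ o ∩ connEvent ends a₂ b)) :=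
    prob_update_one_Q_inter p he (hX_inter (hX_conn he a₂ o) (hX_conn he a₂ b))
  rw [dZ, dx, dy, dD]
  -- names
  set Z₁ := prob p₀ (avoidAll ends a₂ {a₁, v}) with hZ₁
  set Z₀ := prob p₀ (avoidAll ends a₂ {a₁}) with hZ₀
  set x₁ := prob p₀ (avoidAll ends a₂ {a₁, v} ∩ connEvent ends a₂ o) with hx₁
  set y₁ := prob p₀ (avoidAll ends a₂ {a₁, v} ∩ connEvent ends a₂ b) with hy₁
  set D₁ := prob p₀ (avoidAll ends a₂ {a₁, v} ∩ (connEvent ends a₂ o ∩ connEvent ends a₂ b)) with hD₁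
  set x₀ := prob p₀ (avoidAll ends a₂ {a₁} ∩ connEvent ends a₂ o) with hx₀
  set y₀ := prob p₀ (avoidAll ends a₂ {a₁} ∩ connEvent ends a₂ b) with hy₀
  set Dv := prob p₀ (avoidAll ends a₂ {a₁} ∩ (connEvent ends a₁ v ∩ (connEvent ends a₂ o ∩ connEvent ends a₂ b))) with hDv
  set q₁ := prob p₀ (avoidAll ends a₂ {a₁} ∩ (connEvent ends a₁ v ∩ connEvent ends a₂ o)) with hq₁
  set q₂ := prob p₀ (avoidAll ends a₂ {a₁} ∩ (connEvent ends a₁ v ∩ connEvent ends a₂ b)) with hq₂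
  set L₀ := prob p₀ (avoidAll ends a₂ {a₁} ∩ connEvent ends a₁ v) with hL₀
  set π₀ := prob p₀ (connEvent ends a₁ v) with hπ₀
  -- the bounds
  have hPA : x₁ * y₁ ≤ D₁ * Z₁ := by
    have h := bhk_same_cluster_events_avoid p₀ hp0 ends a₂ {a₁, v} (𝓤 := {W | o ∈ W})
      (𝓥 := {W | b ∈ W}) (fun _ _ hWW' ho => hWW' ho) (fun _ _ hWW' hb => hWW' hb)
    have e3 : clusterInEvent ends a₂ ({W | o ∈ W} ∩ {W | b ∈ W}) =
        connEvent ends a₂ o ∩ connEvent ends a₂ b := by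
      ext ω; simp [clusterInEvent, connEvent]
    rw [clusterInEvent_mem_eq, clusterInEvent_mem_eq, e3, Set.inter_comm _ (avoidAll ends a₂ {a₁, v}),
      Set.inter_comm _ (avoidAll ends a₂ {a₁, v}), Set.inter_comm _ (avoidAll ends a₂ {a₁, v})] at h
    exact h
  have hu₂ : q₂ * Z₁ ≤ y₁ * L₀ := bhk_vL_avoid_pair p₀ hp0 a₂ b
  have hHar : L₀ ≤ Z₁ * π₀ := by
    have h := prob_inter_le_prob_mul_prob_of_isLowerSet hp0 (isLowerSet_avoid_pair (ends := ends) (a₁ := a₁) (v := v) a₂)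
      (isUpperSet_connEvent ends a₁ v)
    rw [hL₀, Q_inter_vL_eq' a₂, Set.inter_comm]
    exact h
  have hLZ₁ : L₀ ≤ Z₁ := by
    rw [hL₀, Q_inter_vL_eq' a₂]
    exact prob_mono hp0 Set.inter_subset_right
  have hq₁x : q₁ ≤ x₁ := prob_mono hp0 (Q_inter_vL_inter_subset a₂ _)
  have hq₂y : q₂ ≤ y₁ := prob_mono hp0 (Q_inter_vL_inter_subset a₂ _)
  have hDvD : Dv ≤ D₁ := prob_mono hp0 (Q_inter_vL_inter_subset a₂ _)
  have hZZ : Z₁ ≤ Z₀ := prob_mono hp0 (avoid_pair_subset a₂)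
  have hxx : x₁ ≤ x₀ := prob_mono hp0 (Set.inter_subset_inter_left _ (avoid_pair_subset a₂))
  have hyy : y₁ ≤ y₀ := prob_mono hp0 (Set.inter_subset_inter_left _ (avoid_pair_subset a₂))
  have hq₁L : q₁ ≤ L₀ := prob_mono hp0 (Set.inter_subset_inter_right _ Set.inter_subset_left)
  have hq₂L : q₂ ≤ L₀ := prob_mono hp0 (Set.inter_subset_inter_right _ Set.inter_subset_left)
  have hDvL : Dv ≤ L₀ := prob_mono hp0 (Set.inter_subset_inter_right _ Set.inter_subset_left)
  have hZ₁0 : 0 ≤ Z₁ := prob_nonneg hp0 _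
  have hZ₀0 : 0 ≤ Z₀ := prob_nonneg hp0 _
  have hx₁0 : 0 ≤ x₁ := prob_nonneg hp0 _
  have hy₁0 : 0 ≤ y₁ := prob_nonneg hp0 _
  have hD₁0 : 0 ≤ D₁ := prob_nonneg hp0 _
  have hDv0 : 0 ≤ Dv := prob_nonneg hp0 _
  have hq₁0 : 0 ≤ q₁ := prob_nonneg hp0 _
  have hq₂0 : 0 ≤ q₂ := prob_nonneg hp0 _
  have hL0 : 0 ≤ L₀ := prob_nonneg hp0 _
  have hπ0 : 0 ≤ π₀ := prob_nonneg hp0 _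
  have hπ1 : π₀ ≤ 1 := prob_le_one hp0 _
  -- `E₁` and its certificate times `L₀`
  have key : 0 ≤ L₀ * (2 * Z₁ * Dv - y₁ * q₁ + π₀ * x₁ * y₀ - x₁ * q₂ + 2 * Z₀ * D₁ - y₀ * x₁ +
      π₀ * x₀ * y₁ - x₀ * y₁ + x₀ * y₀ - π₀ * x₀ * y₀) := by
    have t1 : 0 ≤ L₀ * L₀ * Dv := mul_nonneg (mul_nonneg hL0 hL0) hDv0
    have t2 : 0 ≤ L₀ * (Z₀ - Z₁) * Dv := mul_nonneg (mul_nonneg hL0 (sub_nonneg.2 hZZ)) hDv0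
    have t3 : 0 ≤ L₀ * (Z₀ - Z₁) * (D₁ - Dv) :=
      mul_nonneg (mul_nonneg hL0 (sub_nonneg.2 hZZ)) (sub_nonneg.2 hDvD)
    have t4 : 0 ≤ L₀ * (Z₁ - L₀) * Dv := mul_nonneg (mul_nonneg hL0 (sub_nonneg.2 hLZ₁)) hDv0
    have t5 : 0 ≤ L₀ * (x₁ - q₁) * (y₁ - q₂) :=
      mul_nonneg (mul_nonneg hL0 (sub_nonneg.2 hq₁x)) (sub_nonneg.2 hq₂y)
    have t6 : 0 ≤ L₀ * (D₁ * Z₁ - x₁ * y₁) := mul_nonneg hL0 (sub_nonneg.2 hPA)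
    have t7 : 0 ≤ π₀ * L₀ * (x₁ - q₁) * q₂ :=
      mul_nonneg (mul_nonneg (mul_nonneg hπ0 hL0) (sub_nonneg.2 hq₁x)) hq₂0
    have t8 : 0 ≤ π₀ * L₀ * (x₁ - q₁) * (y₁ - q₂) :=
      mul_nonneg (mul_nonneg (mul_nonneg hπ0 hL0) (sub_nonneg.2 hq₁x)) (sub_nonneg.2 hq₂y)
    have t9 : 0 ≤ (1 - π₀) * L₀ * (x₀ - x₁) * (y₀ - y₁) :=
      mul_nonneg (mul_nonneg (mul_nonneg (sub_nonneg.2 hπ1) hL0) (sub_nonneg.2 hxx))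
        (sub_nonneg.2 hyy)
    have t10 : 0 ≤ π₀ * q₁ * (y₁ * L₀ - q₂ * Z₁) :=
      mul_nonneg (mul_nonneg hπ0 hq₁0) (sub_nonneg.2 hu₂)
    have t11 : 0 ≤ q₁ * q₂ * (Z₁ * π₀ - L₀) := mul_nonneg (mul_nonneg hq₁0 hq₂0) (sub_nonneg.2 hHar)
    linarith [t1, t2, t3, t4, t5, t6, t7, t8, t9, t10, t11]
  have hS : 0 ≤ 2 * Z₁ * Dv - y₁ * q₁ + π₀ * x₁ * y₀ - x₁ * q₂ + 2 * Z₀ * D₁ - y₀ * x₁ +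
      π₀ * x₀ * y₁ - x₀ * y₁ + x₀ * y₀ - π₀ * x₀ * y₀ := by
    rcases eq_or_lt_of_le hL0 with hL | hL
    · have h1 : q₁ = 0 := le_antisymm (by rw [← hL] at hq₁L; exact hq₁L) hq₁0
      have h2 : q₂ = 0 := le_antisymm (by rw [← hL] at hq₂L; exact hq₂L) hq₂0
      have h3 : Dv = 0 := le_antisymm (by rw [← hL] at hDvL; exact hDvL) hDv0
      rw [h1, h2, h3]
      have s1 : 0 ≤ (1 - π₀) * (x₀ - x₁) * (y₀ - y₁) :=
        mul_nonneg (mul_nonneg (sub_nonneg.2 hπ1) (sub_nonneg.2 hxx)) (sub_nonneg.2 hyy)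
      have s2 : 0 ≤ (1 - π₀) * (D₁ * Z₁ - x₁ * y₁) := mul_nonneg (sub_nonneg.2 hπ1) (sub_nonneg.2 hPA)
      have s3 : 0 ≤ (1 - π₀) * D₁ * (Z₀ - Z₁) :=
        mul_nonneg (mul_nonneg (sub_nonneg.2 hπ1) hD₁0) (sub_nonneg.2 hZZ)
      have s4 : 0 ≤ (1 + π₀) * (Z₀ * D₁) := mul_nonneg (by linarith) (mul_nonneg hZ₀0 hD₁0)
      linarith [s1, s2, s3, s4]
    · exact (mul_nonneg_iff_of_pos_left hL).1 key
  linarith [hS]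

/-- **The `a₁–v` edge reduction**: for `e = {a₁, v}` of weight `q`,
`(1 − q)²·crossA′so(p[e ↦ 0]) ≤ crossA′so(p)` — the sign of `crossA′so` may be proved with the
`a₁–v` edge deleted (same shape as the root-edge inequality `crossA'so_root_edge`). -/
theorem crossA'so_a1v_edge {p : E → R} (hp : IsProbVec p) (he : ends e = s(a₁, v)) (o a₂ b : V) :
    (1 - p e) ^ 2 * crossA'so (Function.update p e 0) ends o a₁ a₂ v b ≤
      crossA'so p ends o a₁ a₂ v b := by
  have h := crossA'so_a1v_lower hp he o a₂ b
  have hE := E1_nonneg hp he o a₂ b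
  have c1 : 0 ≤ p e * (1 - p e) ^ 2 := mul_nonneg (hp.nonneg e) (sq_nonneg _)
  have := mul_le_mul_of_nonneg_left hE c1
  nlinarith [this, h]

end Main

end CrossAPrimeA1VMid

end Summit.Ventures.PercRepro2
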